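import Mathlib
import HarnessLib

/-!
# Route `IntegerScrew` — the smooth × rough splitting of the harmonic sum: `H_Y ≤ (Σ_{smooth ≤ Y} 1/m)·(Σ_{rough ≤ Y} 1/r)`
# (the hub-mass input of PROPOSITION K″, CONTINUUM-LIMIT §27.1)

PROP. K″ (CONTINUUM-LIMIT §27) redistributes the bottom's mass of a thin-bottom window through the `Q`-ROUGH numbers
`P ∈ (Q, R/Q]` («hubs»); its energy is inversely proportional to the harmonic mass of the hubs, which is bounded below
by the elementary splitting: every `n ≥ 1` is uniquely `m·r` with `m` composed of the primes `< k` and `r` of the primes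
`≥ k`, so

* **`harmonic_le_smooth_mul_rough`** — `Σ_{n ≤ Y} 1/n ≤ (Σ_{m ≤ Y, m k-smooth} 1/m)·(Σ_{r ≤ Y, every prime of r ≥ k} 1/r)`;
* **`sum_inv_rough_ge`** — `Σ_{r ≤ Y, every prime of r ≥ k} 1/r ≥ (Σ_{n≤Y} 1/n)/(Σ_{m ≤ Y, m k-smooth} 1/m)`

(with the tree's Euler-product bound `Σ_{m k-smooth} 1/m ≤ Π_{p<k}(1 − 1/p)⁻¹ ≤ e⁵ log k` this is the hub mass
`≥ log Y/(e⁵ log k)` of §27.1).  The splitting is written with `Nat.factorization` inline (no new definition: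
`m = n.factorization.prod (p,e) ↦ [p < k]·p^e`, `r = n.factorization.prod (p,e) ↦ [k ≤ p]·p^e`).  Mathlib only.
RH-free, elementary.  Nothing in this file bears on the truth of RH.
References: CONTINUUM-LIMIT §27.1 (rh-explicit A6-PIVOT); M. Suzuki, J. Lond. Math. Soc. (2) 108 (2023) 1448–1487
[Suzuki2023] for the screw matrices this serves.
-/

noncomputable section

set_option linter.dupNamespace false -- D-0017: `Summit.<S>.<S>.…` is the designed namespace

namespace Summit.RiemannHypothesis.RiemannHypothesis.Theorems.IntegerScrew

open Finset

/-! ### The two parts of `n` -/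

/-- The smooth part times the rough part is `n`. -/
theorem smoothPart_mul_roughPart_eq (k : ℕ) {n : ℕ} (hn : n ≠ 0) :
    (n.factorization.prod fun p e => if p < k then p ^ e else 1) *
      (n.factorization.prod fun p e => if p < k then 1 else p ^ e) = n := by
  rw [← Finsupp.prod_mul]
  conv_rhs => rw [← Nat.prod_factorization_pow_eq_self hn]
  refine Finsupp.prod_congr fun p _ => ?_
  split_ifs <;> simp

/-- The smooth part is `k`-smooth. -/
theorem smoothPart_mem_smoothNumbers (k n : ℕ) :
    (n.factorization.prod fun p e => if p < k then p ^ e else 1) ∈ Nat.smoothNumbers k := by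
  rw [Nat.mem_smoothNumbers']
  intro q hq hdvd
  unfold Finsupp.prod at hdvd
  obtain ⟨p, hp, hqp⟩ := (Nat.Prime.prime hq).dvd_finsetProd_iff _ |>.1 hdvd
  by_cases hpk : p < k
  · simp only [if_pos hpk] at hqp
    have hpp : p.Prime := Nat.prime_of_mem_primeFactors (Nat.support_factorization n ▸ hp)
    have := (Nat.prime_dvd_prime_iff_eq hq hpp).1 (hq.dvd_of_dvd_pow hqp)
    rw [this]; exact hpk
  · simp only [if_neg hpk] at hqp
    exact absurd (Nat.eq_one_of_dvd_one hqp ▸ hq) Nat.not_prime_one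

/-- Every prime of the rough part is `≥ k`. -/
theorem le_of_mem_primeFactors_roughPart (k n : ℕ) {q : ℕ}
    (hq : q ∈ (n.factorization.prod fun p e => if p < k then 1 else p ^ e).primeFactors) : k ≤ q := by
  have hqp : q.Prime := Nat.prime_of_mem_primeFactors hq
  have hdvd : q ∣ (n.factorization.prod fun p e => if p < k then 1 else p ^ e) := Nat.dvd_of_mem_primeFactors hq
  unfold Finsupp.prod at hdvd
  obtain ⟨p, hp, hqd⟩ := (Nat.Prime.prime hqp).dvd_finsetProd_iff _ |>.1 hdvd
  by_cases hpk : p < k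
  · simp only [if_pos hpk] at hqd
    exact absurd (Nat.eq_one_of_dvd_one hqd ▸ hqp) Nat.not_prime_one
  · simp only [if_neg hpk] at hqd
    have hpp : p.Prime := Nat.prime_of_mem_primeFactors (Nat.support_factorization n ▸ hp)
    have := (Nat.prime_dvd_prime_iff_eq hqp hpp).1 (hqp.dvd_of_dvd_pow hqd)
    rw [this]; omega

/-! ### The splitting of the harmonic sum -/

/-- **`H_Y ≤ (smooth harmonic sum)·(rough harmonic sum)`**: for all `k, Y`,
`Σ_{n ≤ Y} 1/n ≤ (Σ_{m ≤ Y, m k-smooth} 1/m)·(Σ_{r ≤ Y, every prime of r ≥ k} 1/r)`. -/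
theorem harmonic_le_smooth_mul_rough (k Y : ℕ) :
    ∑ n ∈ Icc 1 Y, (1 : ℝ) / n ≤
      (∑ m ∈ (Icc 1 Y).filter (· ∈ Nat.smoothNumbers k), (1 : ℝ) / m) *
        ∑ r ∈ (Icc 1 Y).filter (fun r => ∀ q ∈ r.primeFactors, k ≤ q), (1 : ℝ) / r := by
  set sm : ℕ → ℕ := fun n => n.factorization.prod fun p e => if p < k then p ^ e else 1 with hsm
  set ro : ℕ → ℕ := fun n => n.factorization.prod fun p e => if p < k then 1 else p ^ e with hro
  set S := (Icc 1 Y).filter (· ∈ Nat.smoothNumbers k) with hS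
  set T := (Icc 1 Y).filter (fun r => ∀ q ∈ r.primeFactors, k ≤ q) with hT
  set φ : ℕ → ℕ × ℕ := fun n => (sm n, ro n) with hφ
  have hmul : ∀ n, n ≠ 0 → sm n * ro n = n := fun n hn => smoothPart_mul_roughPart_eq k hn
  -- φ is injective on [1, Y] and lands in S × T
  have hinj : Set.InjOn φ ↑(Icc 1 Y) := by
    intro a ha b hb hab
    have ha0 : a ≠ 0 := by have := (Finset.mem_Icc.1 (Finset.mem_coe.1 ha)).1; omega
    have hb0 : b ≠ 0 := by have := (Finset.mem_Icc.1 (Finset.mem_coe.1 hb)).1; omega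
    have h1 : sm a = sm b := congrArg Prod.fst hab
    have h2 : ro a = ro b := congrArg Prod.snd hab
    rw [← hmul a ha0, ← hmul b hb0, h1, h2]
  have hmaps : (Icc 1 Y).image φ ⊆ S ×ˢ T := by
    intro x hx
    obtain ⟨n, hn, rfl⟩ := Finset.mem_image.1 hx
    have hn' := Finset.mem_Icc.1 hn
    have hn0 : n ≠ 0 := by omega
    have hdvd1 : sm n ∣ n := Dvd.intro _ (hmul n hn0)
    have hdvd2 : ro n ∣ n := Dvd.intro_left _ (hmul n hn0)
    have hs0 : sm n ≠ 0 := fun h => hn0 (Nat.eq_zero_of_zero_dvd (h ▸ hdvd1))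
    have hr0 : ro n ≠ 0 := fun h => hn0 (Nat.eq_zero_of_zero_dvd (h ▸ hdvd2))
    refine Finset.mem_product.2 ⟨?_, ?_⟩
    · refine Finset.mem_filter.2 ⟨Finset.mem_Icc.2 ⟨Nat.one_le_iff_ne_zero.2 hs0,
        (Nat.le_of_dvd (by omega) hdvd1).trans hn'.2⟩, smoothPart_mem_smoothNumbers k n⟩
    · refine Finset.mem_filter.2 ⟨Finset.mem_Icc.2 ⟨Nat.one_le_iff_ne_zero.2 hr0,
        (Nat.le_of_dvd (by omega) hdvd2).trans hn'.2⟩, fun q hq => le_of_mem_primeFactors_roughPart k n hq⟩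
  -- 1/n = (1/sm n)(1/ro n)
  have hterm : ∀ n ∈ Icc 1 Y, (1 : ℝ) / n = (fun x : ℕ × ℕ => (1 : ℝ) / x.1 * ((1 : ℝ) / x.2)) (φ n) := by
    intro n hn
    have hn0 : n ≠ 0 := by have := (Finset.mem_Icc.1 hn).1; omega
    simp only [hφ]
    rw [one_div_mul_one_div, ← Nat.cast_mul, hmul n hn0]
  calc ∑ n ∈ Icc 1 Y, (1 : ℝ) / n
      = ∑ n ∈ Icc 1 Y, (fun x : ℕ × ℕ => (1 : ℝ) / x.1 * ((1 : ℝ) / x.2)) (φ n) := Finset.sum_congr rfl hterm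
    _ = ∑ x ∈ (Icc 1 Y).image φ, (1 : ℝ) / x.1 * ((1 : ℝ) / x.2) :=
        (Finset.sum_image (f := fun x : ℕ × ℕ => (1 : ℝ) / x.1 * ((1 : ℝ) / x.2)) hinj).symm
    _ ≤ ∑ x ∈ S ×ˢ T, (1 : ℝ) / x.1 * ((1 : ℝ) / x.2) :=
        Finset.sum_le_sum_of_subset_of_nonneg hmaps fun x _ _ => by positivity
    _ = (∑ m ∈ S, (1 : ℝ) / m) * ∑ r ∈ T, (1 : ℝ) / r := by
        rw [Finset.sum_product, Finset.sum_mul_sum]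

/-- **The rough harmonic sum from below**: `Σ_{r ≤ Y, every prime of r ≥ k} 1/r ≥ H_Y/(Σ_{m ≤ Y, m k-smooth} 1/m)`
for `Y ≥ 1` (the hub mass of PROP. K″, CONTINUUM-LIMIT §27.1, before the Euler-product bound on the smooth sum). -/
theorem sum_inv_rough_ge {k Y : ℕ} (hY : 1 ≤ Y) :
    (∑ n ∈ Icc 1 Y, (1 : ℝ) / n) / (∑ m ∈ (Icc 1 Y).filter (· ∈ Nat.smoothNumbers k), (1 : ℝ) / m) ≤
      ∑ r ∈ (Icc 1 Y).filter (fun r => ∀ q ∈ r.primeFactors, k ≤ q), (1 : ℝ) / r := by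
  have h1 : 1 ∈ (Icc 1 Y).filter (· ∈ Nat.smoothNumbers k) := by
    refine Finset.mem_filter.2 ⟨Finset.mem_Icc.2 ⟨le_rfl, hY⟩, ?_⟩
    exact Nat.mem_smoothNumbers'.2 fun p hp hd => absurd (Nat.eq_one_of_dvd_one hd ▸ hp) Nat.not_prime_one
  have hpos : 0 < ∑ m ∈ (Icc 1 Y).filter (· ∈ Nat.smoothNumbers k), (1 : ℝ) / m :=
    Finset.sum_pos' (fun m hm => by positivity) ⟨1, h1, by norm_num⟩
  rw [div_le_iff₀ hpos, mul_comm]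
  exact harmonic_le_smooth_mul_rough k Y

end Summit.RiemannHypothesis.RiemannHypothesis.Theorems.IntegerScrew

end
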